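import Mathlib
import Summits.ResolutionOfSingularities.ResolutionOfSingularities.Theorems.RadicialJungCleanModelsPBasisFieldExchange
import Summits.ResolutionOfSingularities.ResolutionOfSingularities.Theorems.RadicialJungCleanModelsPBasisDualDerivations
import HarnessLib

/-!
# Stub `stub_derivation_of_not_mem_adjoin_pow` for crux CleanModels (stmt-15917)

A `k`-derivation moving `g₀`: if `g₀ ∉ k[K^p]` (the `k`-subalgebra generated by `p`-th powers),
there is a derivation `D` of `K = Frac A` with `D g₀ ≠ 0` whose multiple `s • D` (`s ≠ 0`) maps the
finitely generated `A` into `A`.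

Proof route:
1. A maximal `p`-independent `B_k ⊆ k` has `K^p[B_k] ⊇ k`, and `g₀ ∉ K^p[B_k]` (since `K^p[B_k] ⊆
   Algebra.adjoin k (range (·^p))`).
2. By exchange (`pIndep_insert`), `B_k ∪ {g₀}` is `p`-independent.
3. Extend to a maximal `p`-independent `Γ ⊆ K` (`exists_maximal_pIndep`): `IsPBasisOver`.
4. The dual derivation `∂_{g₀}` (`IsPBasisOver.exists_dual_derivation`) has `∂ g₀ = 1` and kills
   `K^p` and `Γ ∖ {g₀} ⊇ B_k`, hence `k`.
5. From `A.FG`, find `s = ∏ denominators` with `s ∂(A) ⊆ A`.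

[folklore]
-/

noncomputable section

set_option linter.dupNamespace false -- mandated namespace of this single-conjunct summit
set_option maxHeartbeats 800000

open Literature.RingTheory.PBasis

namespace Summit.ResolutionOfSingularities.ResolutionOfSingularities.Theorems.RadicialJung.CleanModels

universe u

variable {p : ℕ} [Fact p.Prime] {K : Type u} [Field K] [CharP K p]

/-! ## Derivations kill `p`-th powers -/

omit [Fact p.Prime] in
/-- Every derivation kills `p`-th powers in characteristic `p`. [folklore] -/
theorem derivation_pow_char' (D : Derivation ℤ K K) (a : K) : D (a ^ p) = 0 := by
  rw [D.leibniz_pow, smul_eq_mul, nsmul_eq_mul, CharP.cast_eq_zero K p, zero_mul]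

/-! ## The `p`-closure of `k` is contained in the adjoin of `p`-th powers -/

/-- `K^p[S] ⊆ Algebra.adjoin k (range (·^p))` for any `S ⊆ range (algebraMap k K)`. [folklore] -/
theorem subringClosure_frobenius_union_subset_adjoin_pow {k : Type*} [Field k] [Algebra k K]
    (S : Set K) (hS : S ⊆ Set.range (algebraMap k K)) :
    (Subring.closure (Set.range (frobenius K p) ∪ S) : Set K) ⊆
      Algebra.adjoin k (Set.range fun y : K => y ^ p) := by
  intro x hx
  induction hx using Subring.closure_induction with
  | mem y hy =>
    rcases hy with ⟨z, rfl⟩ | hyS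
    · exact Algebra.subset_adjoin ⟨z, rfl⟩
    · obtain ⟨c, rfl⟩ := hS hyS
      exact Subalgebra.algebraMap_mem _ c
  | one => exact Subalgebra.one_mem _
  | zero => exact Subalgebra.zero_mem _
  | add x y hx' hy' hx hy => exact Subalgebra.add_mem _ hx hy
  | neg x hx' hx => exact Subalgebra.neg_mem _ hx
  | mul x y hx' hy' hx hy => exact Subalgebra.mul_mem _ hx hy

/-! ## p-basis construction -/

/-- The empty family is `p`-independent (vacuously). [folklore] -/
theorem pIndep_empty (κ : Type*) [Field κ] [CharP κ p] :
    ∀ (s : ℕ) (b : Fin s → κ), Function.Injective b → (∀ i, b i ∈ (∅ : Set κ)) →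
      LinearIndependent (frobenius κ p).range (fun n : Fin s → Fin p => ∏ i, b i ^ ((n i : ℕ))) := by
  intro s b _ hb
  cases s with
  | zero =>
    haveI : Unique (Fin 0 → Fin p) := Pi.uniqueOfIsEmpty _
    have hone : (fun n : Fin 0 → Fin p => ∏ i, b i ^ ((n i : ℕ))) = fun _ => 1 := by
      ext n; simp only [Finset.univ_eq_empty, Finset.prod_empty]
    rw [hone, linearIndependent_unique_iff]
    exact one_ne_zero
  | succ s => exfalso; exact hb 0

/-- The subring closure inclusion that converts Subring to Algebra elements. [folklore] -/
theorem mem_adjoin_frobenius_of_subringClosure {Γ : Set K} {x : K}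
    (hx : x ∈ Subring.closure (Set.range (frobenius K p) ∪ Γ)) :
    x ∈ Algebra.adjoin (frobenius K p).range Γ := by
  induction hx using Subring.closure_induction with
  | mem y hy =>
    rcases hy with ⟨z, rfl⟩ | hyΓ
    · -- y = z^p = frobenius z, in the scalars (frobenius K p).range
      have hmem : (frobenius K p) z ∈ (frobenius K p).range := ⟨z, rfl⟩
      exact Subalgebra.algebraMap_mem (Algebra.adjoin (frobenius K p).range Γ) ⟨_, hmem⟩
    · exact Algebra.subset_adjoin hyΓ
  | one => exact Subalgebra.one_mem _
  | zero => exact Subalgebra.zero_mem _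
  | add _ _ _ _ ha hb => exact Subalgebra.add_mem _ ha hb
  | neg _ _ ha => exact Subalgebra.neg_mem _ ha
  | mul _ _ _ _ ha hb => exact Subalgebra.mul_mem _ ha hb

/-- **For `g₀ ∉ k[K^p]` there is a `p`-basis of `K` containing `g₀` with `k ⊆ K^p[Γ ∖ {g₀}]`**.
[folklore] -/
theorem exists_pBasis_containing_of_not_mem_adjoin_pow' {k : Type*} [Field k] [Algebra k K]
    {g₀ : K} (hg₀ : g₀ ∉ Algebra.adjoin k (Set.range fun y : K => y ^ p)) :
    ∃ Γ : Set K, g₀ ∈ Γ ∧ IsPBasisOver p (frobenius K p).range Γ ∧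
      Set.range (algebraMap k K) ⊆ Subring.closure (Set.range (frobenius K p) ∪ (Γ \ {g₀})) := by
  haveI hp : p.Prime := Fact.out
  -- maximal p-independent B_k ⊆ range (algebraMap k K)
  obtain ⟨B_k, _, hB_k_sub, hB_k_indep, hB_k_max⟩ := exists_maximal_pIndep (κ := K) p
    (Set.range (algebraMap k K)) ∅ (Set.empty_subset _) (pIndep_empty K)
  -- g₀ ∉ B_k
  have hg₀_not_Bk : g₀ ∉ B_k := fun hmem => by
    have : algebraMap k K (hB_k_sub hmem).choose = g₀ := (hB_k_sub hmem).choose_spec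
    exact hg₀ (this ▸ Subalgebra.algebraMap_mem _ _)
  -- g₀ ∉ K^p[B_k]
  have hg₀_not : g₀ ∉ Subring.closure (Set.range (frobenius K p) ∪ B_k) := fun hmem =>
    hg₀ (subringClosure_frobenius_union_subset_adjoin_pow B_k
      (hB_k_sub.trans (Set.range_subset_iff.mpr fun c => ⟨c, rfl⟩)) hmem)
  -- by exchange, insert g₀ B_k is p-independent
  have hins_indep := pIndep_insert p B_k hB_k_indep hg₀_not
  -- extend to maximal Γ ⊆ univ
  obtain ⟨Γ, hΓ_ins, _, hΓ_indep, hΓ_max⟩ := exists_maximal_pIndep (κ := K) p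
    Set.univ (insert g₀ B_k) (Set.subset_univ _) hins_indep
  have hg₀Γ : g₀ ∈ Γ := hΓ_ins (Set.mem_insert _ _)
  have hB_k_Γ : B_k ⊆ Γ := fun b hb => hΓ_ins (Set.mem_insert_of_mem _ hb)
  -- IsPBasisOver = generation ∧ independence
  have hΓ_basis : IsPBasisOver p (frobenius K p).range Γ := by
    constructor
    -- generation
    · rw [Algebra.eq_top_iff]
      intro x
      exact mem_adjoin_frobenius_of_subringClosure (hΓ_max (Set.mem_univ x))
    -- independence
    · exact hΓ_indep
  -- range (algebraMap k K) ⊆ K^p[B_k] ⊆ K^p[Γ ∖ {g₀}]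
  have hk_sub : Set.range (algebraMap k K) ⊆
      Subring.closure (Set.range (frobenius K p) ∪ (Γ \ {g₀})) := by
    intro c hc
    have hc' := hB_k_max hc
    refine Subring.closure_mono (Set.union_subset_union_right _ ?_) hc'
    intro b hb
    exact ⟨hB_k_Γ hb, fun h => hg₀_not_Bk (h ▸ hb)⟩
  exact ⟨Γ, hg₀Γ, hΓ_basis, hk_sub⟩

/-- A derivation killing each `γ ∈ Γ` kills every `x ∈ Subring.closure (range frobenius ∪ Γ)`.
[folklore] -/
theorem derivation_eq_zero_of_mem_subringClosure (D : Derivation ℤ K K) (Γ : Set K)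
    (hDΓ : ∀ γ ∈ Γ, D γ = 0)
    {x : K} (hx : x ∈ Subring.closure (Set.range (frobenius K p) ∪ Γ)) : D x = 0 := by
  induction hx using Subring.closure_induction with
  | mem y hy =>
    rcases hy with ⟨a, rfl⟩ | hyΓ
    · exact derivation_pow_char' D a
    · exact hDΓ y hyΓ
  | one => exact D.map_one_eq_zero
  | zero => exact map_zero D
  | add _ _ _ _ ha hb => rw [map_add, ha, hb, add_zero]
  | neg _ _ ha => rw [map_neg, ha, neg_zero]
  | mul _ _ _ _ ha hb => rw [D.leibniz, ha, hb, smul_zero, smul_zero, zero_add]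

/-! ## Denominator for a derivation on generators -/

/-- Helper: if generators have bounded denominators, then all of A does. [folklore] -/
private theorem adjoin_derivation_preserves_aux {k : Type*} [Field k] [Algebra k K]
    (A : Subalgebra k K) (S : Finset K) (hS : Algebra.adjoin k (S : Set K) = A)
    (D : Derivation ℤ K K) (hDk : ∀ c : k, D (algebraMap k K c) = 0)
    (s : K) (hs : ∀ x ∈ S, s * D x ∈ A) :
    ∀ y ∈ A, s * D y ∈ A := by
  intro y hy
  rw [← hS] at hy
  set_option maxHeartbeats 1600000 in
  induction hy using Algebra.adjoin_induction with
  | mem x hxS => exact hs x hxS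
  | algebraMap c => rw [hDk c, mul_zero]; exact A.zero_mem
  | add _ _ _ _ hu hv => rw [map_add, mul_add]; exact A.add_mem hu hv
  | mul u v hu_mem hv_mem hu hv =>
    have hu' : u ∈ A := hS ▸ hu_mem
    have hv' : v ∈ A := hS ▸ hv_mem
    have heq : s * D (u * v) = u * (s * D v) + v * (s * D u) := by
      rw [D.leibniz, smul_eq_mul, smul_eq_mul]; ring
    rw [heq]
    exact A.add_mem (A.mul_mem hu' hv) (A.mul_mem hv' hu)

/-- If `A` is finitely generated over `k` and `D` is a `k`-linear derivation, there exists
`s ≠ 0` such that `s * D(y) ∈ A` for all `y ∈ A`. [folklore] -/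
theorem exists_denom_derivation_preserves {k : Type*} [Field k] [Algebra k K]
    (A : Subalgebra k K) (hAfg : A.FG) [IsFractionRing A K]
    (D : Derivation ℤ K K) (hDk : ∀ c : k, D (algebraMap k K c) = 0) :
    ∃ s : K, s ≠ 0 ∧ ∀ y : K, y ∈ A → s * D y ∈ A := by
  classical
  obtain ⟨S, hS⟩ := hAfg
  -- for each x ∈ S, D x = a_x / b_x with a_x, b_x ∈ A, b_x ≠ 0
  have hfrac : ∀ x : K, ∃ (a b : A), (b : K) ≠ 0 ∧ D x = (a : K) / (b : K) := fun x => by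
    obtain ⟨a, b, hb, hab⟩ := IsFractionRing.div_surjective (A := A) (D x)
    have hb' : (b : K) ≠ 0 := IsFractionRing.to_map_ne_zero_of_mem_nonZeroDivisors hb
    exact ⟨a, b, hb', hab.symm⟩
  choose a b hb_ne hab using fun x : S => hfrac x
  let s : K := ∏ x : S, (b x : K)
  have hs_ne : s ≠ 0 := Finset.prod_ne_zero_iff.mpr (fun x _ => hb_ne x)
  have hs_gen : ∀ x ∈ S, s * D x ∈ A := fun x hxS => by
    have hxS' : (⟨x, hxS⟩ : S) ∈ Finset.univ := Finset.mem_univ _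
    have heq : s * D x = (∏ x' ∈ Finset.univ.erase ⟨x, hxS⟩, (b x' : K)) * (a ⟨x, hxS⟩ : K) := by
      have h1 : D x = (a ⟨x, hxS⟩ : K) / (b ⟨x, hxS⟩ : K) := hab ⟨x, hxS⟩
      have h2 : s = (∏ x' ∈ Finset.univ.erase ⟨x, hxS⟩, (b x' : K)) * (b ⟨x, hxS⟩ : K) :=
        (Finset.prod_erase_mul Finset.univ (fun x' => (b x' : K)) hxS').symm
      calc s * D x = s * ((a ⟨x, hxS⟩ : K) / (b ⟨x, hxS⟩ : K)) := by rw [h1]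
        _ = (∏ x' ∈ Finset.univ.erase ⟨x, hxS⟩, (b x' : K)) * (b ⟨x, hxS⟩ : K) *
              ((a ⟨x, hxS⟩ : K) / (b ⟨x, hxS⟩ : K)) := by rw [h2]
        _ = (∏ x' ∈ Finset.univ.erase ⟨x, hxS⟩, (b x' : K)) * (a ⟨x, hxS⟩ : K) := by
            rw [mul_assoc, mul_div_cancel₀ _ (hb_ne ⟨x, hxS⟩)]
    rw [heq]
    exact A.mul_mem (A.prod_mem fun x' _ => (b x').2) (a ⟨x, hxS⟩).2
  exact ⟨s, hs_ne, adjoin_derivation_preserves_aux A S hS D hDk s hs_gen⟩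

/-- **Main theorem**: for `g₀ ∉ k[K^p]` there is a derivation `D` with `D g₀ ≠ 0` and `s * D(A) ⊆ A`
for some `s ≠ 0`. [folklore] -/
theorem stub_derivation_of_not_mem_adjoin_pow :
    ∀ (p : ℕ), p.Prime →
    ∀ (k : Type) [Field k] [CharP k p] (K : Type) [Field K] [Algebra k K] (A : Subalgebra k K),
      A.FG → IsFractionRing A K →
    ∀ g₀ : K, g₀ ∉ Algebra.adjoin k (Set.range fun y : K => y ^ p) →
    ∃ (D : Derivation ℤ K K) (s : K), s ≠ 0 ∧ (∀ y : K, y ∈ A → s * D y ∈ A) ∧ D g₀ ≠ 0 := by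
  intro p hp k _ _ K _ _ A hAfg hfrac g₀ hg₀
  haveI : Fact p.Prime := ⟨hp⟩
  haveI : CharP K p := charP_of_injective_algebraMap (algebraMap k K).injective p
  obtain ⟨Γ, hg₀Γ, hΓ, hk_sub⟩ := exists_pBasis_containing_of_not_mem_adjoin_pow' (K := K) hg₀
  obtain ⟨D, hD1, hD0⟩ := IsPBasisOver.exists_dual_derivation hΓ ⟨g₀, hg₀Γ⟩
  have hD_Γminus : ∀ γ ∈ Γ \ {g₀}, D γ = 0 := fun γ ⟨hγΓ, hγne⟩ =>
    hD0 ⟨γ, hγΓ⟩ (fun h => hγne (Set.mem_singleton_iff.mpr (congrArg Subtype.val h)))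
  have hDk : ∀ c : k, D (algebraMap k K c) = 0 := fun c =>
    derivation_eq_zero_of_mem_subringClosure D (Γ \ {g₀}) hD_Γminus (hk_sub ⟨c, rfl⟩)
  obtain ⟨s, hs_ne, hs_mem⟩ := exists_denom_derivation_preserves A hAfg D hDk
  exact ⟨D, s, hs_ne, hs_mem, by rw [hD1]; exact one_ne_zero⟩

end Summit.ResolutionOfSingularities.ResolutionOfSingularities.Theorems.RadicialJung.CleanModels

end
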